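import Summits.MatrixMultiplication.OmegaCensus.DihC3SqReb

/-!
# ω-census, family (b3): the class `𝒞₂` — normal forms of label configurations and words of re-basings

HONEST FRAMING (pub-omega census; verbatim): lottery ticket; floor = certified bounds/negative ranges.
Census BOOKKEEPING (prereg P-031.3, session A); group-free; nothing here is progress on `ω`.

* `holNF n = holCfg (nfParams n) n` — a greedy `Hol(F₃²)` normal form of a configuration (translate the first reflection
  label to `k = 0`, then bring the first non-zero vector to `e₁` and the first vector independent of it to `e₂`).  Only the
  SHAPE `holCfg _ n` matters for soundness (`bound16_of_holNF`); that it is a normal form keeps the certified list short.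
* `applyWord w n` — a word in the re-basings / sortings `rebT, rebU, srtT, srtU`; `bound16_applyWord`.
* `AllBound` — conjunction of `Bound16` over a list (the form in which the certificate files are collected).
-/

namespace Summit.MatrixMultiplication.OmegaCensus.DihC3Sq

/-! ## The greedy normal form -/

/-- The four labels of configuration `n`. [folklore] -/
def labs (n : ℕ) : List ℕ := [n % 18, n / 18 % 18, n / 324 % 18, n / 5832 % 18]

/-- `det (x₁,y₁) (x₂,y₂) = x₁ y₂ − x₂ y₁ (mod 3)` on coordinates `< 3`. [folklore] -/
def det3 (x1 y1 x2 y2 : ℕ) : ℕ := (x1 * y2 + 2 * (x2 * y1)) % 3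

/-- Step 1: the translation `b₀ = −k` of the first reflection label (or `0`). [folklore] -/
def nfTransl (L : List ℕ) : ℕ × ℕ :=
  match L.find? (fun l => decide (9 ≤ l)) with
  | none => (0, 0)
  | some l => ((3 - l % 3) % 3, (3 - l / 3 % 3) % 3)

/-- Step 2: the echelon matrix `((a,b),(c,d))` of a label list: first non-zero vector `↦ e₁`, first vector independent of
it `↦ e₂` (identity if all vectors vanish). [folklore] -/
def nfMatrix (L : List ℕ) : ℕ × ℕ × ℕ × ℕ :=
  match L.find? (fun l => decide (l % 9 ≠ 0)) with
  | none => (1, 0, 0, 1)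
  | some wa =>
      let xa := wa % 3
      let ya := wa / 3 % 3
      let u : ℕ × ℕ :=
        match L.find? (fun l => decide (det3 xa ya (l % 3) (l / 3 % 3) ≠ 0)) with
        | some wb => (wb % 3, wb / 3 % 3)
        | none => if det3 xa ya 1 0 ≠ 0 then (1, 0) else (0, 1)
      let D := det3 xa ya u.1 u.2
      (D * u.2 % 3, D * (2 * u.1) % 3, D * (2 * ya) % 3, D * xa % 3)

/-- The parameters `(a, b, c, d, bx, by)` of the normalising element: `A` from step 2 applied after step 1, translation
`A b₀`. [folklore] -/
def nfParams (n : ℕ) : ℕ × ℕ × ℕ × ℕ × ℕ × ℕ :=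
  let b0 := nfTransl (labs n)
  let L1 := (labs n).map (holAct 1 0 0 1 b0.1 b0.2)
  let M := nfMatrix L1
  (M.1, M.2.1, M.2.2.1, M.2.2.2, (M.1 * b0.1 + M.2.1 * b0.2) % 3, (M.2.2.1 * b0.1 + M.2.2.2 * b0.2) % 3)

/-- The normal form `holNF n = holCfg (nfParams n) n`. [folklore] -/
def holNF (n : ℕ) : ℕ :=
  let P := nfParams n
  holCfg P.1 P.2.1 P.2.2.1 P.2.2.2.1 P.2.2.2.2.1 P.2.2.2.2.2 n

/-- Invertibility of a parameter tuple (`det A ≠ 0 mod 3`). [folklore] -/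
def detOK (P : ℕ × ℕ × ℕ × ℕ × ℕ × ℕ) : Bool := decide ((P.1 * P.2.2.2.1 + 2 * (P.2.1 * P.2.2.1)) % 3 ≠ 0)

/-- A passing `detOK` gives an invertible matrix over `ZMod 3`. [folklore] -/
theorem det_ne_zero_of_detOK {P : ℕ × ℕ × ℕ × ℕ × ℕ × ℕ} (h : detOK P = true) (h1 : P.1 < 3) (h2 : P.2.1 < 3)
    (h3 : P.2.2.1 < 3) (h4 : P.2.2.2.1 < 3) :
    (P.1 : ZMod 3) * (P.2.2.2.1 : ℕ) - (P.2.1 : ℕ) * (P.2.2.1 : ℕ) ≠ 0 := by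
  simp only [detOK, decide_eq_true_eq] at h
  have key : ∀ a : ℕ, a < 3 → ∀ b : ℕ, b < 3 → ∀ c : ℕ, c < 3 → ∀ d : ℕ, d < 3 → (a * d + 2 * (b * c)) % 3 ≠ 0 →
      (a : ZMod 3) * (d : ℕ) - (b : ℕ) * (c : ℕ) ≠ 0 := by decide
  exact key _ h1 _ h2 _ h3 _ h4 h

/-- Parameter bounds and invertibility, as one Boolean check. [folklore] -/
def paramsOK (P : ℕ × ℕ × ℕ × ℕ × ℕ × ℕ) : Bool :=
  decide (P.1 < 3) && decide (P.2.1 < 3) && decide (P.2.2.1 < 3) && decide (P.2.2.2.1 < 3) && detOK P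

/-- **`Bound16` moves from the normal form.** [folklore] -/
theorem bound16_of_holNF {n : ℕ} (hP : paramsOK (nfParams n) = true) : Bound16 (holNF n) → Bound16 n := by
  simp only [paramsOK, Bool.and_eq_true, decide_eq_true_eq] at hP
  obtain ⟨⟨⟨⟨h1, h2⟩, h3⟩, h4⟩, hd⟩ := hP
  exact bound16_of_holCfg _ _ (det_ne_zero_of_detOK hd h1 h2 h3 h4) n

/-- **`Bound16` moves against any invertible parameter tuple** (used with the inverse elements of the table). [folklore] -/
theorem bound16_of_params {P : ℕ × ℕ × ℕ × ℕ × ℕ × ℕ} (hP : paramsOK P = true) (n : ℕ) :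
    Bound16 (holCfg P.1 P.2.1 P.2.2.1 P.2.2.2.1 P.2.2.2.2.1 P.2.2.2.2.2 n) → Bound16 n := by
  simp only [paramsOK, Bool.and_eq_true, decide_eq_true_eq] at hP
  obtain ⟨⟨⟨⟨h1, h2⟩, h3⟩, h4⟩, hd⟩ := hP
  exact bound16_of_holCfg _ _ (det_ne_zero_of_detOK hd h1 h2 h3 h4) n

/-! ## Words of re-basings and sortings -/

/-- Apply the generator `g` (`0 = rebT`, `1 = rebU`, `2 = srtT`, otherwise `srtU`). [folklore] -/
def applyGen (g n : ℕ) : ℕ := if g = 0 then rebT n else if g = 1 then rebU n else if g = 2 then srtT n else srtU n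

/-- Apply a word (left to right). [folklore] -/
def applyWord : List ℕ → ℕ → ℕ
  | [], n => n
  | g :: w, n => applyWord w (applyGen g n)

/-- `Bound16` moves along one generator. [folklore] -/
theorem bound16_applyGen (g n : ℕ) (h : Bound16 n) : Bound16 (applyGen g n) := by
  unfold applyGen; split_ifs
  exacts [bound16_rebT n h, bound16_rebU n h, bound16_srtT n h, bound16_srtU n h]

/-- **`Bound16` moves along words.** [folklore] -/
theorem bound16_applyWord (w : List ℕ) : ∀ (n : ℕ), Bound16 n → Bound16 (applyWord w n) := by
  induction w with
  | nil => intro n h; rw [applyWord]; exact h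
  | cons g w ih => intro n h; rw [applyWord]; exact ih _ (bound16_applyGen g n h)

/-! ## Collecting bounds over lists -/

/-- `Bound16` for every member of a list, as a nested conjunction (filled by the certificate files). [folklore] -/
def AllBound : List ℕ → Prop
  | [] => True
  | r :: l => Bound16 r ∧ AllBound l

/-- Members of an `AllBound` list are bounded. [folklore] -/
theorem bound16_of_allBound : ∀ {l : List ℕ}, AllBound l → ∀ r ∈ l, Bound16 r
  | [], _, r, hr => by simp at hr
  | x :: l, h, r, hr => by
      rcases List.mem_cons.1 hr with rfl | hr
      · exact h.1
      · exact bound16_of_allBound h.2 r hr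

/-! ## A search tree for fast kernel membership -/

/-- Binary search trees of naturals (the certified normal forms are looked up through one; a 329-element `List.elem` costs
the kernel ≈ 25 ms, a tree lookup ≈ 1 ms). [folklore] -/
inductive NT where
  /-- the empty tree -/
  | nil : NT
  /-- a node with left subtree, value, right subtree -/
  | node : NT → ℕ → NT → NT

/-- Membership by binary search (sound for ANY tree: a hit is a stored value). [folklore] -/
def NT.mem (x : ℕ) : NT → Bool
  | .nil => false
  | .node l v r => if x < v then l.mem x else if v < x then r.mem x else true

/-- The stored values, in order. [folklore] -/
def NT.toList : NT → List ℕ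
  | .nil => []
  | .node l v r => l.toList ++ v :: r.toList

/-- Soundness of tree membership: a hit is a stored value. [folklore] -/
theorem NT.mem_toList {x : ℕ} : ∀ {t : NT}, t.mem x = true → x ∈ t.toList
  | .nil, h => by simp [NT.mem] at h
  | .node l v r, h => by
      simp only [NT.mem] at h
      rw [NT.toList, List.mem_append, List.mem_cons]
      split_ifs at h with h1 h2
      · exact Or.inl (NT.mem_toList h)
      · exact Or.inr (Or.inr (NT.mem_toList h))
      · exact Or.inr (Or.inl (by omega))

/-! ## The table machinery -/

/-- A table entry: normal form `s`, inverse parameters `P` (so that `holCfg P s = applyWord w r`), representative `r`,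
word `w`. [folklore] -/
structure Entry where
  /-- the normal form -/
  s : ℕ
  /-- parameters of the inverse normalising element -/
  P : ℕ × ℕ × ℕ × ℕ × ℕ × ℕ
  /-- the orbit representative -/
  r : ℕ
  /-- the word of re-basings / sortings -/
  w : List ℕ

/-- The check of one entry against a list of representatives. [folklore] -/
def entryOK (reps : List ℕ) (e : Entry) : Bool :=
  paramsOK e.P && (holCfg e.P.1 e.P.2.1 e.P.2.2.1 e.P.2.2.2.1 e.P.2.2.2.2.1 e.P.2.2.2.2.2 e.s == applyWord e.w e.r) &&
    reps.elem e.r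

/-- **Entries transfer bounds**: if every representative is bounded and the entry checks, its normal form is bounded.
[folklore] -/
theorem bound16_of_entryOK {reps : List ℕ} (hreps : AllBound reps) {e : Entry} (h : entryOK reps e = true) :
    Bound16 e.s := by
  simp only [entryOK, Bool.and_eq_true, beq_iff_eq, List.elem_iff] at h
  obtain ⟨⟨hP, he⟩, hr⟩ := h
  refine bound16_of_params hP e.s ?_
  rw [he]
  exact bound16_applyWord e.w e.r (bound16_of_allBound hreps e.r hr)

/-- The sweep check of one configuration against a search tree of certified normal forms. [folklore] -/
def nfOK (S : NT) (n : ℕ) : Bool := !sorted n || (paramsOK (nfParams n) && S.mem (holNF n))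

/-- **Sweep soundness.** [folklore] -/
theorem bound16_of_nfOK {S : NT} (hS : ∀ s ∈ S.toList, Bound16 s) {n : ℕ} (h : nfOK S n = true) (hs : sorted n = true) :
    Bound16 n := by
  simp only [nfOK, hs, Bool.not_true, Bool.false_or, Bool.and_eq_true] at h
  exact bound16_of_holNF h.1 (hS _ (NT.mem_toList h.2))

end Summit.MatrixMultiplication.OmegaCensus.DihC3Sq
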